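import Summits.RiemannHypothesis.RiemannHypothesis.Theorems.Splittings.PolyDoorRealAxis
import Summits.RiemannHypothesis.RiemannHypothesis.Theorems.Splittings.PolyDoorLocalSign
import Literature.LinearAlgebra.Matrix.GershgorinCounting
import Literature.LinearAlgebra.Matrix.CompanionMatrix

/-!
# LINE L13 «DBR POLYNOMIAL DOOR» — APEX tools: the deformation `E_t = P + i t P′`, pinned real roots, local sign

Cell rh-split, route `DeBrangesSuzukiDoor`, support for item `stmt-RiemannHypothesis-21502` (`PolyDoorCount`, the
line's APEX; registrar rh-split-dbr-neg g16; THEOREM B of card SPLIT-dbr-neg §20 at `h = 0`).  The count itself is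
in `PolyDoorCount.lean`; this file supplies the pieces of the classical homotopy proof (Hermite–Biehler for
`(p, p′)`; Levin 1964 ch. VII):
* multiset counting (`countP_add_countP_le_card`, `countP_im_nonneg_eq`);
* the deformation `E_t := P + C (i t) · P′` of a monic `P` of degree `n ≥ 1` as the characteristic polynomial of a
  CONTINUOUS family of companion matrices (`exists_matrix_family`, via the tree's
  `Literature.LinearAlgebra.Matrix.charpoly_companion`), so that the tree's continuity-of-counts engine
  (`Literature.LinearAlgebra.Matrix.Gershgorin.eventually_countP_roots_charpoly_le` / `eventually_le_…`: the
  number of roots in a closed set can only drop nearby, in an open set only grow) applies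
  (`eventually_le_countP_of_isOpen`, `eventually_countP_le_of_isClosed`);
* REAL AXIS (`filter_real_roots_eq`): for `t ≠ 0` a real zero of `E_t` is a common zero of `P, P′`, and at a root
  `x` of `P` of multiplicity `k + 1` both `P′` and `E_t` have `x` as a root of multiplicity exactly `k`; so the
  multiset of real roots of `E_t` is independent of `t ≠ 0`;
* LOCAL SIGN (`local_sign`): near a root `x` with `P = (X − x)^{k+1} r`, `r(x) ≠ 0`, a zero `w ≠ x` of `E_t`
  satisfies `w − x = −i t (k+1) · r(w)/(r(w) + i t r′(w))`, whose imaginary part is `< 0` for `(t, w)` near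
  `(0⁺, x)`.

E-GENERAL, RH-free.  RECORD line: RH is NOT proved by this, nor approached.
HONEST LABEL: known mathematics, 0 summit credit; nothing here bears on the truth of RH.
-/

set_option linter.dupNamespace false

namespace Summit.RiemannHypothesis.RiemannHypothesis.Theorems.Splittings.PolyDoorCountTools

open Polynomial Filter Topology Set
open Literature.LinearAlgebra.Matrix (companion companion_apply charpoly_companion)
open Literature.LinearAlgebra.Matrix.Gershgorin (eventually_countP_roots_charpoly_le
  eventually_le_countP_roots_charpoly)

/-! ## Multiset counting -/

/-- Two predicates that are disjoint on `s` count at most `card s` elements together. [folklore] -/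
theorem countP_add_countP_le_card {α : Type*} (s : Multiset α) (p q : α → Prop) [DecidablePred p]
    [DecidablePred q] (h : ∀ a ∈ s, p a → q a → False) :
    s.countP p + s.countP q ≤ Multiset.card s := by
  induction s using Multiset.induction_on with
  | empty => simp
  | cons a s ih =>
    have ih' := ih (fun b hb => h b (Multiset.mem_cons_of_mem hb))
    have ha := h a (Multiset.mem_cons_self a s)
    rw [Multiset.countP_cons, Multiset.countP_cons, Multiset.card_cons]
    by_cases hp : p a
    · rw [if_pos hp, if_neg (fun hq => ha hp hq)]
      omega
    · rw [if_neg hp]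
      split_ifs <;> omega

/-- `#{Im ≥ 0} = #{Im > 0} + #{Im = 0}` on a multiset of complex numbers. [folklore] -/
theorem countP_im_nonneg_eq (s : Multiset ℂ) :
    s.countP (fun z => 0 ≤ z.im) = s.countP (fun z => 0 < z.im) + s.countP (fun z => z.im = 0) := by
  induction s using Multiset.induction_on with
  | empty => simp
  | cons a s ih =>
    simp only [Multiset.countP_cons, ih]
    rcases lt_trichotomy 0 a.im with h | h | h
    · rw [if_pos h.le, if_pos h, if_neg h.ne']
      omega
    · rw [if_pos h.le, if_neg (by rw [← h]; exact lt_irrefl 0), if_pos h.symm]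
      omega
    · rw [if_neg (not_le.2 h), if_neg (not_lt.2 h.le), if_neg h.ne]
      omega

/-! ## The deformation `E_t = P + i t P′` as a family of characteristic polynomials -/

/-- For `P` monic of positive degree, `P + C u · P′` is monic of the same degree. [folklore] -/
theorem monic_add_C_mul_derivative {P : ℂ[X]} (hP : P.Monic) (hn : 0 < P.natDegree) (u : ℂ) :
    (P + C u * derivative P).Monic ∧ (P + C u * derivative P).natDegree = P.natDegree := by
  have hlt : (C u * derivative P).natDegree < P.natDegree :=
    (natDegree_C_mul_le u _).trans_lt (natDegree_derivative_lt hn.ne')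
  exact ⟨hP.add_of_left (degree_lt_degree hlt), natDegree_add_eq_left_of_natDegree_lt hlt⟩

/-- Coefficients of `P + C u · P′`. [folklore] -/
theorem coeff_add_C_mul_derivative (P : ℂ[X]) (u : ℂ) (i : ℕ) :
    (P + C u * derivative P).coeff i = P.coeff i + u * (derivative P).coeff i := by
  simp only [coeff_add, coeff_C_mul]

/-- The companion matrix depends continuously on the coefficient vector. [folklore] -/
theorem continuous_companion (n : ℕ) : Continuous (fun a : Fin n → ℂ => companion a) := by
  refine continuous_matrix fun i j => ?_
  simp only [companion_apply]
  split_ifs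
  · exact (continuous_apply i).neg
  · exact continuous_const
  · exact continuous_const

/-- The deformation `t ↦ E_t = P + i t P′` of a monic `P` of degree `n ≥ 1` is the characteristic polynomial of
a continuous family of `n × n` matrices (companion matrices). [folklore] -/
theorem exists_matrix_family {P : ℂ[X]} (hP : P.Monic) {n : ℕ} (hn : P.natDegree = n) (hpos : 0 < n) :
    ∃ A : ℝ → Matrix (Fin n) (Fin n) ℂ, Continuous A ∧
      ∀ t : ℝ, (A t).charpoly = P + C (Complex.I * t) * derivative P := by
  refine ⟨fun t => companion (fun i : Fin n => P.coeff i + Complex.I * t * (derivative P).coeff i), ?_, ?_⟩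
  · refine (continuous_companion n).comp (continuous_pi fun i => ?_)
    fun_prop
  · intro t
    obtain ⟨hm, hdeg⟩ := monic_add_C_mul_derivative hP (hn ▸ hpos) (Complex.I * t)
    rw [charpoly_companion]
    conv_rhs => rw [hm.as_sum]
    rw [hdeg, hn, Finset.sum_range (fun i => C ((P + C (Complex.I * ↑t) * derivative P).coeff i) * X ^ i)]
    simp only [coeff_add_C_mul_derivative]

/-- Engine, open form: along the family the number of roots of `E_t` in an open set can only grow near
any `t₀`. [folklore] (`Literature.LinearAlgebra.Matrix.Gershgorin.eventually_le_countP_roots_charpoly`.) -/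
theorem eventually_le_countP_of_isOpen {n : ℕ} {A : ℝ → Matrix (Fin n) (Fin n) ℂ} (hA : Continuous A)
    {E : ℝ → ℂ[X]} (hAE : ∀ t, (A t).charpoly = E t) {q : ℂ → Prop} [DecidablePred q]
    (hq : IsOpen {z | q z}) (t₀ : ℝ) :
    ∀ᶠ t in 𝓝 t₀, (E t₀).roots.countP q ≤ (E t).roots.countP q := by
  have h := eventually_le_countP_roots_charpoly hA hq t₀
  simp only [hAE] at h
  exact h

/-- Engine, closed form: along the family the number of roots of `E_t` in a closed set can only drop near
any `t₀`. [folklore] (`Literature.LinearAlgebra.Matrix.Gershgorin.eventually_countP_roots_charpoly_le`.) -/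
theorem eventually_countP_le_of_isClosed {n : ℕ} {A : ℝ → Matrix (Fin n) (Fin n) ℂ} (hA : Continuous A)
    {E : ℝ → ℂ[X]} (hAE : ∀ t, (A t).charpoly = E t) {q : ℂ → Prop} [DecidablePred q]
    (hq : IsClosed {z | q z}) (t₀ : ℝ) :
    ∀ᶠ t in 𝓝 t₀, (E t).roots.countP q ≤ (E t₀).roots.countP q := by
  have h := eventually_countP_roots_charpoly_le hA hq t₀
  simp only [hAE] at h
  exact h

/-! ## The real axis: multiplicities at a root of `P` -/

/-- `f = (X − x)^j · B` with `B(x) ≠ 0` has `x` as a root of multiplicity exactly `j`. [folklore] -/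
theorem rootMultiplicity_eq_of_eq_pow_mul {f B : ℂ[X]} {x : ℂ} {j : ℕ} (h : f = (X - C x) ^ j * B)
    (hB : B.eval x ≠ 0) : f.rootMultiplicity x = j := by
  have hB0 : B ≠ 0 := by
    rintro rfl
    simp at hB
  have h0 : (X - C x) ^ j * B ≠ 0 := mul_ne_zero (pow_ne_zero _ (X_sub_C_ne_zero x)) hB0
  rw [h, rootMultiplicity_mul h0, rootMultiplicity_X_sub_C_pow, rootMultiplicity_eq_zero (fun h' => hB h'),
    add_zero]

/-- `((X − x)^{k+1} r)′ = (X − x)^k ((k+1) r + (X − x) r′)`. [folklore] -/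
theorem derivative_factor (x : ℂ) (r : ℂ[X]) (k : ℕ) :
    derivative ((X - C x) ^ (k + 1) * r) = (X - C x) ^ k * (C ((k : ℂ) + 1) * r + (X - C x) * derivative r) := by
  simp only [derivative_mul, derivative_pow_succ, derivative_sub, derivative_X, derivative_C, sub_zero, mul_one]
  ring

/-- `(X − x)^{k+1} r + u·((X − x)^{k+1} r)′ = (X − x)^k ((X − x) r + u((k+1) r + (X − x) r′))`. [folklore] -/
theorem door_factor (x : ℂ) (r : ℂ[X]) (k : ℕ) (u : ℂ) :
    (X - C x) ^ (k + 1) * r + C u * derivative ((X - C x) ^ (k + 1) * r) =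
      (X - C x) ^ k * ((X - C x) * r + C u * (C ((k : ℂ) + 1) * r + (X - C x) * derivative r)) := by
  rw [derivative_factor]
  ring

/-- **Real roots of `E_t` are pinned.**  If `P ≠ 0` takes real values with real derivative on `ℝ` (e.g. `P` is
the complexification of a real polynomial) then for `t ≠ 0` the multiset of real roots of `E_t = P + i t P′`
equals the multiset of real roots of `P′` that are roots of `P` — independent of `t`. [folklore] -/
theorem filter_real_roots_eq {P : ℂ[X]} (hP0 : P ≠ 0)
    (hreal : ∀ x : ℝ, (P.eval (x : ℂ)).im = 0 ∧ ((derivative P).eval (x : ℂ)).im = 0)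
    {t : ℝ} (ht : t ≠ 0) :
    (P + C (Complex.I * t) * derivative P).roots.filter (fun z => z.im = 0) =
      (derivative P).roots.filter (fun z => z.im = 0 ∧ P.eval z = 0) := by
  classical
  refine Multiset.ext.mpr fun z => ?_
  rw [Multiset.count_filter, Multiset.count_filter, count_roots, count_roots]
  by_cases hz : z.im = 0
  · by_cases hPz : P.eval z = 0
    · rw [if_pos hz, if_pos ⟨hz, hPz⟩]
      obtain ⟨r, hfac, hndvd⟩ := P.exists_eq_pow_rootMultiplicity_mul_and_not_dvd hP0 z
      have hm : 0 < P.rootMultiplicity z := (rootMultiplicity_pos hP0).2 hPz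
      have hrz : r.eval z ≠ 0 := fun h => hndvd (dvd_iff_isRoot.2 h)
      obtain ⟨k, hk⟩ : ∃ k, P.rootMultiplicity z = k + 1 := ⟨P.rootMultiplicity z - 1, by omega⟩
      rw [hk] at hfac
      have h1 : (P + C (Complex.I * t) * derivative P).rootMultiplicity z = k := by
        refine rootMultiplicity_eq_of_eq_pow_mul (by rw [hfac, door_factor]) ?_
        simp only [eval_add, eval_mul, eval_sub, eval_X, eval_C, sub_self, zero_mul, zero_add, add_zero]
        exact mul_ne_zero (mul_ne_zero Complex.I_ne_zero (Complex.ofReal_ne_zero.2 ht))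
          (mul_ne_zero (Nat.cast_add_one_ne_zero k) hrz)
      have h2 : (derivative P).rootMultiplicity z = k := by
        refine rootMultiplicity_eq_of_eq_pow_mul (by rw [hfac, derivative_factor]) ?_
        simp only [eval_add, eval_mul, eval_sub, eval_X, eval_C, sub_self, zero_mul, add_zero]
        exact mul_ne_zero (Nat.cast_add_one_ne_zero k) hrz
      rw [h1, h2]
    · rw [if_pos hz, if_neg (fun h => hPz h.2), rootMultiplicity_eq_zero]
      intro hroot
      apply hPz
      have hzre : ((z.re : ℝ) : ℂ) = z := Complex.ext (by simp) (by simp [hz])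
      have him := hreal z.re
      rw [hzre] at him
      have h0 : (P + C (Complex.I * t) * derivative P).eval z = 0 := hroot
      rw [eval_add, eval_mul, eval_C] at h0
      have hre := congrArg Complex.re h0
      simp only [Complex.add_re, Complex.mul_re, Complex.mul_im, Complex.I_re, Complex.I_im,
        Complex.ofReal_re, Complex.ofReal_im, him.2, zero_mul, mul_zero, sub_zero, one_mul, zero_add,
        add_zero, Complex.zero_re] at hre
      exact Complex.ext (by simpa using hre) (by simpa using him.1)
  · rw [if_neg hz, if_neg (fun h => hz h.1)]

/-! ## Near a real root: the escaping zero goes down -/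

/-- **Local sign near a root of `P`.**  Let `P = (X − x)^{k+1} r` with `r(x) ≠ 0`.  There is `δ > 0` such that for
`0 < t < δ` every zero `w` of `E_t = P + i t P′` with `‖w − x‖ < δ` is either `x` itself or satisfies
`Im (w − x) < 0`: indeed `w − x = −i t (k+1) · r(w)/(r(w) + i t r′(w))` and the last factor has real part near `1`.
[folklore] -/
theorem local_sign (r : ℂ[X]) (x : ℂ) (hrx : r.eval x ≠ 0) (k : ℕ) :
    ∃ δ : ℝ, 0 < δ ∧ ∀ t : ℝ, 0 < t → t < δ → ∀ w : ℂ, ‖w - x‖ < δ →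
      ((X - C x) ^ (k + 1) * r + C (Complex.I * t) * derivative ((X - C x) ^ (k + 1) * r)).eval w = 0 →
      w = x ∨ (w - x).im < 0 := by
  have hDc : Continuous fun q : ℝ × ℂ =>
      r.eval q.2 + Complex.I * (q.1 : ℂ) * (derivative r).eval q.2 := by
    fun_prop
  have hNc : Continuous fun q : ℝ × ℂ => r.eval q.2 := by fun_prop
  have hD0 : r.eval x + Complex.I * ((0 : ℝ) : ℂ) * (derivative r).eval x ≠ 0 := by
    simpa using hrx
  have hF : ContinuousAt (fun q : ℝ × ℂ =>
      r.eval q.2 / (r.eval q.2 + Complex.I * (q.1 : ℂ) * (derivative r).eval q.2)) ((0 : ℝ), x) :=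
    hNc.continuousAt.div hDc.continuousAt hD0
  have hF1 : r.eval x / (r.eval x + Complex.I * ((0 : ℝ) : ℂ) * (derivative r).eval x) = 1 := by
    rw [Complex.ofReal_zero, mul_zero, zero_mul, add_zero, div_self hrx]
  have hFre : ContinuousAt (fun q : ℝ × ℂ =>
      (r.eval q.2 / (r.eval q.2 + Complex.I * (q.1 : ℂ) * (derivative r).eval q.2)).re) ((0 : ℝ), x) :=
    Complex.continuous_re.continuousAt.comp hF
  have hre : ∀ᶠ q : ℝ × ℂ in 𝓝 ((0 : ℝ), x),
      (1 / 2 : ℝ) < (r.eval q.2 / (r.eval q.2 + Complex.I * (q.1 : ℂ) * (derivative r).eval q.2)).re := by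
    refine Filter.Tendsto.eventually_const_lt ?_ hFre
    show (1 / 2 : ℝ) < (r.eval x / (r.eval x + Complex.I * ((0 : ℝ) : ℂ) * (derivative r).eval x)).re
    rw [hF1, Complex.one_re]
    norm_num
  have hne : ∀ᶠ q : ℝ × ℂ in 𝓝 ((0 : ℝ), x),
      r.eval q.2 + Complex.I * (q.1 : ℂ) * (derivative r).eval q.2 ≠ 0 :=
    hDc.continuousAt.eventually_ne hD0
  obtain ⟨δ, hδ, hball⟩ := Metric.eventually_nhds_iff.1 (hre.and hne)
  refine ⟨δ, hδ, fun t ht htδ w hw hEw => ?_⟩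
  rcases eq_or_ne w x with hwx | hwx
  · exact Or.inl hwx
  right
  have hdist : dist ((t, w) : ℝ × ℂ) ((0 : ℝ), x) < δ := by
    rw [Prod.dist_eq, Real.dist_eq, sub_zero, abs_of_pos ht, Complex.dist_eq]
    exact max_lt htδ hw
  obtain ⟨hre', hne'⟩ := hball hdist
  dsimp only at hre' hne'
  -- the algebra: `(w − x)(r(w) + i t r′(w)) = −i t (k+1) r(w)`
  rw [eval_add, PolyDoorLocalSign.eval_factor, eval_mul, eval_C, PolyDoorLocalSign.eval_derivative_factor]
    at hEw
  have hbr : (w - x) * (r.eval w + Complex.I * t * (derivative r).eval w) =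
      -(Complex.I * t * ((k : ℂ) + 1)) * r.eval w := by
    have h1 : (w - x) ^ k * ((w - x) * (r.eval w + Complex.I * t * (derivative r).eval w) +
        Complex.I * t * ((k : ℂ) + 1) * r.eval w) = 0 := by
      calc _ = (w - x) ^ (k + 1) * r.eval w + Complex.I * ↑t *
            ((w - x) ^ k * (((k : ℂ) + 1) * r.eval w + (w - x) * (derivative r).eval w)) := by ring
        _ = 0 := hEw
    have h2 := (mul_eq_zero.1 h1).resolve_left (pow_ne_zero _ (sub_ne_zero.2 hwx))
    linear_combination h2
  have key : w - x = -(Complex.I * t * ((k : ℂ) + 1)) *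
      (r.eval w / (r.eval w + Complex.I * t * (derivative r).eval w)) := by
    rw [← mul_div_assoc, ← hbr, mul_div_cancel_right₀ _ hne']
  rw [key]
  have him : ∀ F : ℂ, (-(Complex.I * t * ((k : ℂ) + 1)) * F).im = -(t * ((k : ℝ) + 1)) * F.re := by
    intro F
    simp only [neg_mul, Complex.neg_im, Complex.mul_im, Complex.mul_re, Complex.I_re, Complex.I_im,
      Complex.ofReal_re, Complex.ofReal_im, Complex.natCast_re, Complex.natCast_im, Complex.add_re,
      Complex.add_im, Complex.one_re, Complex.one_im]
    ring
  rw [him]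
  have hpos : 0 < t * ((k : ℝ) + 1) := by positivity
  nlinarith

end Summit.RiemannHypothesis.RiemannHypothesis.Theorems.Splittings.PolyDoorCountTools
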